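import Summits.CriticalPhenomena.CardyFormulaZ2.Theorems.CardyBoundaryCoulombGasBoundaryDefectGaussianRStubTransportPathsPart3
import Summits.CriticalPhenomena.CardyFormulaZ2.Theorems.CardyBoundaryCoulombGasBoundaryDefectGaussianRStubTransportPathsPart5

/-!
# Stub `stub_transportPaths` of line `rainbow-monomials-in-excursion-kernels` — Part 6:
# the bottom-left corner (anchor edge of TRANSPORT) and a second corner
# (crux `CardyBoundaryCoulombGas.BoundaryDefectGaussianR`, stmt-CriticalPhenomena-14132)

For an oriented rectilinear Jordan domain (`γ = D.boundary`, orientation clause of TRANSPORT at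
one parameter):

* `tp_bottom_left` — the lexicographically lowest point `p = γ t` of `closure D` (minimal
  imaginary part, then minimal real part; compactness) is a CONVEX CORNER whose outgoing edge is
  the horizontal ray to the right with the interior above: in the oriented wedge at `t` one has
  `a = 0`, `m = 1` (rays pointing down or to the left, and the three-quadrant sector, would put
  points of `closure D` below `p`). Its outgoing edge is the flat bottom-type stretch on which the
  anchors `a n` of TRANSPORT are placed;
* `tp_second_corner` — there is another non-flat parameter in `(t, t + 1)` (otherwise one
  coordinate of `γ` would be constant on a whole period, contradicting the two perpendicular germs
  at `t`). Hence the polygon has at least two corners per period.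
All [folklore].
-/

noncomputable section

open Set Filter Metric Topology
open Literature.Probability.RandomPlanarGeometry
open Summit.CriticalPhenomena.CardyFormulaZ2.Cruxes.RectilinearCardy.ExcursionKernelCovariance

namespace Summit.CriticalPhenomena.CardyFormulaZ2.Cruxes.BoundaryDefectGaussianR.RainbowMonomialsInExcursionKernels

/-- **The bottom-left corner.** For a Jordan domain whose frontier is covered by finitely many
axis-parallel segments and whose boundary loop satisfies the orientation clause of TRANSPORT at
one parameter, there is a parameter `t ∈ [0, 1)` whose image `p = γ t` has minimal imaginary
part among the points of `closure D` and minimal real part among the frontier points of that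
imaginary part; `p` is not flat, and the oriented wedge at `t` has outgoing ray `[0, ∞)`
(exponent `0`), incoming ray `i [0, ∞)` and ONE quadrant: the domain near `p` is the open
quadrant `{re > p.re, im > p.im}`. [folklore] -/
theorem tp_bottom_left (D : JordanDomain) {S : Finset (ℂ × ℂ)}
    (hS : ∀ q ∈ S, q.1.re = q.2.re ∨ q.1.im = q.2.im)
    (hcov : frontier D.carrier ⊆ ⋃ q ∈ S, segment ℝ q.1 q.2) {t₁ : ℝ}
    (hor : ∃ τ : ℂ, ‖τ‖ = 1 ∧
      (∃ ε : ℝ, 0 < ε ∧ ∀ t ∈ Ioo t₁ (t₁ + ε), ∃ s : ℝ, 0 < s ∧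
        D.boundary t = D.boundary t₁ + (s : ℂ) * τ) ∧
      (∃ ε : ℝ, 0 < ε ∧ ∀ s ∈ Ioo (0 : ℝ) ε,
        D.boundary t₁ + (s : ℂ) * (τ * Complex.I) ∈ D.carrier)) :
    ∃ t ∈ Ico (0 : ℝ) 1,
      (∀ z ∈ closure D.carrier, (D.boundary t).im ≤ z.im) ∧
      (∀ z ∈ frontier D.carrier, z.im = (D.boundary t).im → (D.boundary t).re ≤ z.re) ∧
      (¬ ∃ r' : ℝ, 0 < r' ∧
        ((∀ z ∈ frontier D.carrier, dist z (D.boundary t) < r' → z.im = (D.boundary t).im) ∨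
          (∀ z ∈ frontier D.carrier, dist z (D.boundary t) < r' → z.re = (D.boundary t).re))) ∧
      ∃ r η : ℝ, 0 < r ∧ 0 < η ∧ η ≤ 1 / 4 ∧
        (∀ t' ∈ Icc t (t + η), D.boundary t' =
          D.boundary t + ((‖D.boundary t' - D.boundary t‖ : ℝ) : ℂ) * Complex.I ^ 0) ∧
        StrictMonoOn (fun t' => ‖D.boundary t' - D.boundary t‖) (Icc t (t + η)) ∧
        r < ‖D.boundary (t + η) - D.boundary t‖ ∧
        (∀ t' ∈ Icc (t - η) t, D.boundary t' =
          D.boundary t + ((‖D.boundary t' - D.boundary t‖ : ℝ) : ℂ) * Complex.I ^ (0 + 1)) ∧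
        StrictAntiOn (fun t' => ‖D.boundary t' - D.boundary t‖) (Icc (t - η) t) ∧
        r < ‖D.boundary (t - η) - D.boundary t‖ ∧
        (∀ z, dist z (D.boundary t) < r → (z ∈ frontier D.carrier ↔
          (((z - D.boundary t) * (-Complex.I) ^ 0).im = 0 ∧
              0 ≤ ((z - D.boundary t) * (-Complex.I) ^ 0).re) ∨
            (((z - D.boundary t) * (-Complex.I) ^ (0 + 1)).im = 0 ∧
              0 ≤ ((z - D.boundary t) * (-Complex.I) ^ (0 + 1)).re))) ∧
        (∀ z, dist z (D.boundary t) < r → (z ∈ D.carrier ↔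
          (1 = 1 → 0 < ((z - D.boundary t) * (-Complex.I) ^ 0).re ∧
              0 < ((z - D.boundary t) * (-Complex.I) ^ 0).im) ∧
            (1 = 2 → 0 < ((z - D.boundary t) * (-Complex.I) ^ 0).im) ∧
            (1 = 3 → 0 < ((z - D.boundary t) * (-Complex.I) ^ 0).im ∨
              ((z - D.boundary t) * (-Complex.I) ^ 0).re < 0))) := by
  -- the lowest point of the closure
  have hK : IsCompact (closure D.carrier) := D.isBounded.isCompact_closure
  have hne : (closure D.carrier).Nonempty := D.nonempty.mono subset_closure
  obtain ⟨q, hqK, hqmin⟩ := hK.exists_isMinOn hne Complex.continuous_im.continuousOn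
  have hqmin' : ∀ z ∈ closure D.carrier, q.im ≤ z.im := fun z hz => (isMinOn_iff.1 hqmin) z hz
  have hqD : q ∉ D.carrier := by
    intro hq
    obtain ⟨ε, hε, hball⟩ := Metric.isOpen_iff.1 D.isOpen q hq
    have hmem : q - ((ε / 2 : ℝ) : ℂ) * Complex.I ∈ D.carrier := by
      refine hball ?_
      rw [mem_ball, dist_eq_norm, sub_sub_cancel_left, norm_neg, norm_mul, Complex.norm_real,
        Complex.norm_I, mul_one, Real.norm_eq_abs, abs_of_pos (half_pos hε)]
      linarith
    have h := hqmin' _ (subset_closure hmem)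
    simp at h
    linarith
  have hqf : q ∈ frontier D.carrier := ⟨hqK, by rwa [D.isOpen.interior_eq]⟩
  -- the leftmost frontier point of that height
  have hFc : IsCompact (frontier D.carrier ∩ {z | z.im ≤ q.im}) :=
    (hK.of_isClosed_subset isClosed_frontier frontier_subset_closure).inter_right
      (isClosed_le Complex.continuous_im continuous_const)
  have hqF : q ∈ frontier D.carrier ∩ {z | z.im ≤ q.im} := ⟨hqf, by show q.im ≤ q.im; exact le_rfl⟩
  obtain ⟨p, hpF, hpmin⟩ := hFc.exists_isMinOn ⟨q, hqF⟩ Complex.continuous_re.continuousOn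
  have hpf : p ∈ frontier D.carrier := hpF.1
  have hp2 : p.im ≤ q.im := hpF.2
  have hpim : p.im = q.im := le_antisymm hp2 (hqmin' p (frontier_subset_closure hpf))
  have hmin1 : ∀ z ∈ closure D.carrier, p.im ≤ z.im := fun z hz => by rw [hpim]; exact hqmin' z hz
  have hmin2 : ∀ z ∈ frontier D.carrier, z.im = p.im → p.re ≤ z.re := fun z hz hzi =>
    (isMinOn_iff.1 hpmin) z ⟨hz, by rw [mem_setOf_eq, hzi, hpim]⟩
  -- its parameter and the oriented wedge there
  obtain ⟨t, ht, htp⟩ : ∃ t ∈ Ico (0 : ℝ) 1, D.boundary t = p := by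
    have : p ∈ D.boundary '' Ico 0 1 := by rw [← D.frontier_eq_image_Ico]; exact hpf
    exact this
  subst htp
  obtain ⟨r, η, a, m, hr, hη, hη4, ha4, hm, hdirA, hmonoA, hrA, hdirB, hantiB, hrB, -, hfront,
    hfirst⟩ := tp_wedgeAt_oriented D hS hcov hor t
  set γ := D.boundary with hγ
  -- points of the two rays are frontier points
  have hray : ∀ b : ℕ, (b = a ∨ b = a + m) → ∀ s : ℝ, 0 < s → s < r →
      γ t + (s : ℂ) * Complex.I ^ b ∈ frontier D.carrier := by
    intro b hb s hs0 hsr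
    have hd : dist (γ t + (s : ℂ) * Complex.I ^ b) (γ t) < r := by
      rw [dist_eq_norm, add_sub_cancel_left, norm_mul, norm_pow, Complex.norm_I, one_pow, mul_one,
        Complex.norm_real, Real.norm_eq_abs, abs_of_pos hs0]
      exact hsr
    have hu : (γ t + (s : ℂ) * Complex.I ^ b - γ t) * (-Complex.I) ^ b = (s : ℂ) := by
      rw [add_sub_cancel_left, mul_assoc, I_pow_mul_neg_I_pow, mul_one]
    refine (hfront _ hd).2 ?_
    rcases hb with rfl | rfl
    · exact Or.inl ⟨by rw [hu, Complex.ofReal_im], by rw [hu, Complex.ofReal_re]; exact hs0.le⟩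
    · exact Or.inr ⟨by rw [hu, Complex.ofReal_im], by rw [hu, Complex.ofReal_re]; exact hs0.le⟩
  -- so both ray directions point up, or horizontally to the right
  have hdirs : ∀ b : ℕ, (b = a ∨ b = a + m) →
      0 ≤ (Complex.I ^ b).im ∧ ((Complex.I ^ b).im = 0 → 0 ≤ (Complex.I ^ b).re) := by
    intro b hb
    have hz := hray b hb (r / 2) (by positivity) (by linarith)
    have h1 := hmin1 _ (frontier_subset_closure hz)
    simp only [Complex.add_im, Complex.mul_im, Complex.ofReal_re, Complex.ofReal_im, zero_mul,
      add_zero, le_add_iff_nonneg_right] at h1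
    refine ⟨nonneg_of_mul_nonneg_right h1 (by positivity), fun him => ?_⟩
    have h2 := hmin2 _ hz (by simp [him])
    simp only [Complex.add_re, Complex.mul_re, Complex.ofReal_re, Complex.ofReal_im, zero_mul,
      sub_zero, le_add_iff_nonneg_right] at h2
    exact nonneg_of_mul_nonneg_right h2 (by positivity)
  -- the three-quadrant sector after a vertical outgoing ray would reach below `p`
  have hnot13 : ¬ (a = 1 ∧ m = 3) := by
    rintro ⟨rfl, rfl⟩
    have hd : dist (γ t - ((r / 2 : ℝ) : ℂ) * Complex.I) (γ t) < r := by
      rw [dist_eq_norm, sub_sub_cancel_left, norm_neg, norm_mul, Complex.norm_real, Complex.norm_I,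
        mul_one, Real.norm_eq_abs, abs_of_pos (half_pos hr)]
      linarith
    have hu : (γ t - ((r / 2 : ℝ) : ℂ) * Complex.I - γ t) * (-Complex.I) ^ 1 =
        -((r / 2 : ℝ) : ℂ) := by
      rw [sub_sub_cancel_left, pow_one]; ring_nf; rw [Complex.I_sq]; ring
    have hz : γ t - ((r / 2 : ℝ) : ℂ) * Complex.I ∈ D.carrier := by
      refine (hfirst _ hd).2 ⟨fun h => absurd h (by norm_num), fun h => absurd h (by norm_num),
        fun _ => Or.inr ?_⟩
      rw [hu, Complex.neg_re, Complex.ofReal_re]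
      linarith
    have h := hmin1 _ (subset_closure hz)
    simp at h
    linarith
  have hA := hdirs a (Or.inl rfl)
  have hB := hdirs (a + m) (Or.inr rfl)
  obtain ⟨rfl, rfl⟩ : a = 0 ∧ m = 1 := by
    have hall := And.intro hA (And.intro hB hnot13)
    interval_cases a <;> rcases hm with rfl | rfl | rfl <;>
      first | exact ⟨rfl, rfl⟩ | (exfalso; norm_num [pow_succ] at hall)
  refine ⟨t, ht, hmin1, hmin2, fun hfl => ?_, r, η, hr, hη, hη4, hdirA, hmonoA, hrA, hdirB, hantiB,
    hrB, hfront, hfirst⟩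
  have h2 := tp_two_of_flat D hr hη (by norm_num) (Or.inl rfl) hdirA hrA hdirB hrB hfl
  norm_num at h2

/-- **A second corner.** If at the parameter `t` the outgoing germ of the loop runs along
`[0, ∞)` and the incoming germ along `i [0, ∞)` (beyond a positive radius), then some parameter
of `(t, t + 1)` is not flat: otherwise one coordinate of the loop would be constant on the whole
period `[t, t + 1]` (`tp_const_coord`), contradicting the two perpendicular germs. [folklore] -/
theorem tp_second_corner (D : JordanDomain) {t r η : ℝ} (hr : 0 < r) (hη : 0 < η)
    (hη4 : η ≤ 1 / 4)
    (hdirA : ∀ t' ∈ Icc t (t + η), D.boundary t' =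
      D.boundary t + ((‖D.boundary t' - D.boundary t‖ : ℝ) : ℂ) * Complex.I ^ 0)
    (hrA : r < ‖D.boundary (t + η) - D.boundary t‖)
    (hdirB : ∀ t' ∈ Icc (t - η) t, D.boundary t' =
      D.boundary t + ((‖D.boundary t' - D.boundary t‖ : ℝ) : ℂ) * Complex.I ^ (0 + 1))
    (hrB : r < ‖D.boundary (t - η) - D.boundary t‖) :
    ∃ t' ∈ Ioo t (t + 1), ¬ ∃ r' : ℝ, 0 < r' ∧
      ((∀ z ∈ frontier D.carrier, dist z (D.boundary t') < r' → z.im = (D.boundary t').im) ∨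
        (∀ z ∈ frontier D.carrier, dist z (D.boundary t') < r' → z.re = (D.boundary t').re)) := by
  by_contra h
  push Not at h
  rcases tp_const_coord D (by linarith : t < t + 1) h with him | hre
  · -- constant imaginary part: contradicted by the vertical incoming germ
    have hs : t - η + 1 ∈ Icc t (t + 1) := ⟨by linarith, by linarith⟩
    have hper : D.boundary (t - η + 1) = D.boundary (t - η) := D.periodic_boundary (t - η)
    have h1 := him _ hs
    rw [hper, hdirB (t - η) ⟨le_rfl, by linarith⟩] at h1
    simp at h1
    have h2 : ‖D.boundary (t - η) - D.boundary t‖ = 0 := by rw [h1, norm_zero]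
    linarith
  · -- constant real part: contradicted by the horizontal outgoing germ
    have hs : t + η ∈ Icc t (t + 1) := ⟨by linarith, by linarith⟩
    have h1 := hre _ hs
    rw [hdirA (t + η) ⟨by linarith, le_rfl⟩] at h1
    simp at h1
    have h2 : ‖D.boundary (t + η) - D.boundary t‖ = 0 := by rw [h1, norm_zero]
    linarith

/-- **Registered sub-goal `s7_secondCorner` of stub `stub_transportPaths`** (a second corner per
period, one-line form of `tp_second_corner`). [folklore] -/
theorem s7_secondCorner : ∀ (D : Literature.Probability.RandomPlanarGeometry.JordanDomain) (t r η : ℝ), 0 < r → 0 < η → η ≤ 1 / 4 → (∀ t' ∈ Set.Icc t (t + η), D.boundary t' = D.boundary t + ((‖D.boundary t' - D.boundary t‖ : ℝ) : ℂ) * Complex.I ^ 0) → r < ‖D.boundary (t + η) - D.boundary t‖ → (∀ t' ∈ Set.Icc (t - η) t, D.boundary t' = D.boundary t + ((‖D.boundary t' - D.boundary t‖ : ℝ) : ℂ) * Complex.I ^ (0 + 1)) → r < ‖D.boundary (t - η) - D.boundary t‖ → ∃ t' ∈ Set.Ioo t (t + 1), ¬ ∃ r' : ℝ, 0 < r' ∧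 ((∀ z ∈ frontier D.carrier, dist z (D.boundary t') < r' → z.im = (D.boundary t').im) ∨ (∀ z ∈ frontier D.carrier, dist z (D.boundary t') < r' → z.re = (D.boundary t').re)) :=
  fun D _ _ _ hr hη hη4 hdirA hrA hdirB hrB => tp_second_corner D hr hη hη4 hdirA hrA hdirB hrB

end Summit.CriticalPhenomena.CardyFormulaZ2.Cruxes.BoundaryDefectGaussianR.RainbowMonomialsInExcursionKernels

end
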